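import Summits.Ventures.HodgeKum4.Invariants

/-!
# H3 / Kum⁴ — lemma node L3 (the fixed-fourfold span) and `Γ(X)`-averaging

Cell `hodge-kum4` (ladder HodgeAV, rung H3), namespace `Summit.Ventures.HodgeKum4`.  HONEST FRAMING: nothing
here asserts that a case of the Hodge conjecture is proved.  Every `def … : Prop` is a STATEMENT — an
obligation of the cell or a print input offered for vendoring — and every `theorem` is kernel glue
(standard axioms, no `sorry`).  H3 is a rung, not a thesis: nothing is glued to `Summit.HodgeConjecture`.
This module is one topic of the FROZEN TYPING (planner seat; semantic audit PASS 5934162d on the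
single-file form sha16 e3550acdea16baa3, of which the present files are a split by topic with no change of
any statement or proof); the INDEX is `Summits/Ventures/HodgeKum4/Statement.lean`.

## §4 L3 — fixed-fourfold span (p2).  Lowest risk; one elementary unpublished number
OFFICIAL `FixedFourfoldSpanKum4` (splitting form: `c = c₀ + (c - c₀)`, `c₀` `Γ`-invariant rational
`(p,p)`, `c - c₀` algebraic).  Second layer: `GammaFiniteKum4` (L3a), `GammaCoinvariantClassesAlgebraicKum4`
(L3b), the `gammaAverage` API and KERNEL glue `fixedFourfoldSpan_of_finite_of_coinvariant`; p2's nodes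
VERBATIM: `middleRep`, `Kum4NonInvariantClassesAlgebraic` (L3°), inputs `Kum4TranslationGroup` (F_Γ,
PRINT), `Kum4TranslationGroupTrivialOffMiddle` (F_Γ′, PRINT), `Kum4FixedFourfoldClasses` (I:
`[W₀]·[W_x] = 1` CELL-PROVED, not in print; `[W₀]² = 6 ≠ 1` print-reducible), KERNEL glue
`gammaFinite_of_translationGroup`, `gammaCoinvariant_of`; p2's KERNEL `F_Γ → I → L3°` (orbit-span
lemma; ref item G5 unnecessary, G1 = `mem_algebraicClasses_map_iff_of_iso`) lands in p2's files.
-/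

noncomputable section

open CategoryTheory
open Literature.AlgebraicTopology.SingularHomology
open Literature.AlgebraicGeometry Literature.AlgebraicGeometry.HodgeTheory
  Literature.AlgebraicGeometry.Hyperkaehler

namespace Summit.Ventures.HodgeKum4

-- commutator bracket on `gl(H*)`, Mathlib's local-instance idiom (as in `Hyperkaehler/LooijengaLuntsVerbitsky`)
attribute [local instance 100] LieRing.ofAssociativeRing

/-! ### §4 L3 — the fixed-fourfold span (seat p2) -/

/-- **The representation of `Γ(X)` on `H⁸(X(ℂ); ℂ)`** (seat p2), `g ↦ (g⁻¹)^*`. -/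
def middleRep (X : Motives.SchemeOver ℂ) :
    Representation ℂ (autFixingH2H3 X) (complexBetti X 8) where
  toFun g := (complexBetti.map (g⁻¹ : autFixingH2H3 X).val.hom 8).hom
  map_one' := by
    rw [inv_one]
    change (complexBetti.map (𝟙 X) 8).hom = _
    rw [complexBetti.map_id]
    rfl
  map_mul' g h := by
    rw [mul_inv_rev]
    change (complexBetti.map ((g⁻¹).val.hom ≫ (h⁻¹).val.hom) 8).hom = _
    rw [complexBetti.map_comp]
    rfl

/-- `ρ(g) c = (g⁻¹)^* c` (seat p2). -/
theorem middleRep_apply {X : Motives.SchemeOver ℂ} (g : autFixingH2H3 X) (c : complexBetti X 8) :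
    middleRep X g c = (complexBetti.map (g⁻¹ : autFixingH2H3 X).val.hom 8).hom c :=
  rfl

/-- **L3° (seat p2's L3, verbatim) — the `Γ(X)`-non-invariant part of `H⁸` is algebraic**: for every
smooth projective `Kum⁴`-type `X`, the augmentation submodule `𝒦 = span{ρ(g)c - c} ⊂ H⁸(X(ℂ); ℂ)`
(`Representation.Coinvariants.ker`) consists of algebraic classes of codimension `4` (the `624`
canonical `(4,4)`-classes, one per non-trivial character of `Γ ≅ (ℤ/5)⁴`, `ℚ`-combinations of the
classes of the `625` fixed fourfolds `W_x`).  KERNEL from F_Γ ∧ I (p2: `kum4NonInvariantClassesAlgebraic_of`,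
orbit-span lemma). -/
def Kum4NonInvariantClassesAlgebraic : Prop :=
  ∀ ⦃X : Motives.SchemeOver ℂ⦄, Motives.IsSmoothProjective 8 X → IsOfGeneralizedKummerType 4 X →
    Representation.Coinvariants.ker (middleRep X) ≤ algebraicClasses X 4

/-- **Input F_Γ (PRINT, REFEREED; seat p2's statement verbatim): `|Γ(X)| = 625` and `dim 𝒦 ≤ 624`** for
`X` smooth projective of `Kum⁴`-type (`|Aut₀| = 2·625`: Boissière–Nieper-Wißkirchen–Sarti 2011 JMPA 95,
Hassett–Tschinkel 2013 Thm. 2.1/Prop. 3.1, Oguiso 2020; `dim 𝒦 ≤ 624`: Foster 2024 Rmk. 88 "spanned by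
a `Γ`-regular representation" ⟹ multiplicity `≤ 1` — ref R0: anchor on Rmk. 88, NOT on Prop. 87's
off-middle sentence; `b₈ = 1046`, `dim (H⁸)^Γ = 422`, lit row L3.6).  Offered for vendoring (lit/p2). -/
def Kum4TranslationGroup : Prop :=
  ∀ ⦃X : Motives.SchemeOver ℂ⦄, Motives.IsSmoothProjective 8 X → IsOfGeneralizedKummerType 4 X →
    Nat.card (autFixingH2H3 X) = 625 ∧
      Module.finrank ℂ (Representation.Coinvariants.ker (middleRep X)) ≤ 624

/-- **Input F_Γ′ (PRINT, REFEREED; seat p2's statement verbatim): `Γ(X)` acts trivially on `Hᵏ(X(ℂ); ℂ)`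
for every `k ≠ 8`** (ref R0: anchor on Foster 2024 Rmk. 88 — `i^*`-surjectivity `H^k(A^{[5]}) → H^k`
for `k < 8` — plus `Γ`-equivariant Poincaré duality for `k > 8` and Hassett–Tschinkel's deformation
invariance; NOT on Prop. 87's off-middle sentence; lit row L3.6). -/
def Kum4TranslationGroupTrivialOffMiddle : Prop :=
  ∀ ⦃X : Motives.SchemeOver ℂ⦄, Motives.IsSmoothProjective 8 X → IsOfGeneralizedKummerType 4 X →
    ∀ (k : ℕ), k ≠ 8 → ∀ g : Aut X, g ∈ autFixingH2H3 X → complexBetti.map g.hom k = 𝟙 _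

/-- **Input I (CELL-PROVED ON PAPER, NOT IN PRINT; seat p2 verbatim) — the fixed-fourfold class and its
Gram functional**: an ALGEBRAIC class `w ∈ H⁸(X(ℂ); ℂ)` and a functional `φ` with `φ(ρ(g) w) = 1` for
`g ≠ 1` and `φ(w) ≠ 1`.  Intended: `w = cl(W_X)` (Floccari 2026 Def. 4.1/Lem. 4.2/Prop. 4.6, REFEREED:
the maximal component of `Fix(ι)`, deforming with `X`; ref item G1 — its `625` translates `ρ(g)w` are
algebraic by `mem_algebraicClasses_map_iff_of_iso`, KERNEL), `φ = ∫_X w ∪ ·`; values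
`[W₀]·[W_x] = 1` (`x ≠ 0`; census L4 / ref g3; flag F6: every `ι ∘ t_x` is `Γ`-conjugate to `ι`,
`2 ∈ (ℤ/5)ˣ`) and `[W₀]² = Sign(ι, X) = σ(X) - 624 = 630 - 624 = 6 ≠ 1` (G2-AUDIT §A5′: Hirzebruch 1969
(6) + Floccari Lem. 4.2/KMO (erratum-safe) + Göttsche–Soergel + Hodge–Riemann; ref g4).  Only `≠ 1`
is consumed. -/
def Kum4FixedFourfoldClasses : Prop :=
  ∀ ⦃X : Motives.SchemeOver ℂ⦄, Motives.IsSmoothProjective 8 X → IsOfGeneralizedKummerType 4 X →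
    ∃ (w : complexBetti X 8) (φ : complexBetti X 8 →ₗ[ℂ] ℂ), w ∈ algebraicClasses X 4 ∧
      (∀ g : autFixingH2H3 X, g ≠ 1 → φ (middleRep X g w) = 1) ∧ φ w ≠ 1

/-- **L3a — `Γ(X)` is finite** (for `X` smooth projective of `Kum⁴`-type; from F_Γ, or directly from
print). -/
def GammaFiniteKum4 : Prop :=
  ∀ ⦃X : Motives.SchemeOver ℂ⦄, Motives.IsSmoothProjective 8 X → IsOfGeneralizedKummerType 4 X →
    Finite (autFixingH2H3 X)

/-- **L3b — `Γ(X)`-coinvariant classes are algebraic, all degrees**: `g^* c - c ∈ algebraicClasses X p`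
for every `g ∈ Γ(X)` and EVERY `c ∈ H²ᵖ(X(ℂ); ℂ)` (degree `8`: L3°; other degrees: `Γ(X)` acts
trivially, F_Γ′). -/
def GammaCoinvariantClassesAlgebraicKum4 : Prop :=
  ∀ ⦃X : Motives.SchemeOver ℂ⦄, Motives.IsSmoothProjective 8 X → IsOfGeneralizedKummerType 4 X →
    ∀ (p : ℕ) (c : complexBetti X (2 * p)) (g : Aut X), g ∈ autFixingH2H3 X →
      complexBetti.map g.hom (2 * p) c - c ∈ algebraicClasses X p

/-- **L3 (OFFICIAL) — fixed-fourfold span, splitting form**: on a smooth projective `Kum⁴`-type `X`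
every rational `(p,p)`-class `c` splits as `c = c₀ + (c - c₀)` with `c₀` a `Γ(X)`-INVARIANT rational
`(p,p)`-class and `c - c₀` algebraic. -/
def FixedFourfoldSpanKum4 : Prop :=
  ∀ ⦃X : Motives.SchemeOver ℂ⦄, Motives.IsSmoothProjective 8 X → IsOfGeneralizedKummerType 4 X →
    ∀ (p : ℕ) (c : complexBetti X (2 * p)), IsRationalClass c → IsOfHodgeType 8 X (2 * p) p p c →
      ∃ c₀ : complexBetti X (2 * p), IsRationalClass c₀ ∧ IsOfHodgeType 8 X (2 * p) p p c₀ ∧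
        IsGammaInvariant X c₀ ∧ c - c₀ ∈ algebraicClasses X p

/-- **KERNEL glue: F_Γ ⟹ L3a.** -/
theorem gammaFinite_of_translationGroup (hΓ : Kum4TranslationGroup) : GammaFiniteKum4 :=
  fun _ hX hK ↦ Nat.finite_of_card_ne_zero (by rw [(hΓ hX hK).1]; norm_num)

/-- **KERNEL glue: L3° ∧ F_Γ′ ⟹ L3b.**  In degree `8`, `g^* c - c = ρ(g⁻¹) c - c ∈ 𝒦`; in degrees
`≠ 8`, `g^* = 1`. -/
theorem gammaCoinvariant_of (h3 : Kum4NonInvariantClassesAlgebraic)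
    (hoff : Kum4TranslationGroupTrivialOffMiddle) : GammaCoinvariantClassesAlgebraicKum4 := by
  intro X hX hK p c g hg
  by_cases hp : p = 4
  · subst hp
    change complexBetti.map g.hom 8 c - c ∈ algebraicClasses X 4
    refine h3 hX hK ?_
    have h := Representation.Coinvariants.sub_mem_ker (ρ := middleRep X) (⟨g, hg⟩⁻¹ : autFixingH2H3 X) c
    rwa [middleRep_apply, inv_inv] at h
  · have h := hoff hX hK (2 * p) (by omega) g hg
    rw [h]
    simp

section Averaging

/-- A finite sum of rational classes is rational. -/
theorem isRationalClass_sum {X : Motives.SchemeOver ℂ} {k : ℕ} {ι : Type*} (s : Finset ι)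
    (f : ι → complexBetti X k) (hf : ∀ i ∈ s, IsRationalClass (f i)) : IsRationalClass (∑ i ∈ s, f i) :=
  Finset.sum_induction f (fun x ↦ IsRationalClass x) (fun _ _ ha hb ↦ ha.add hb)
    IsRationalClass.zero hf

/-- Pull-back by `h ∈ Γ(X)` permutes the terms `γ^* c`, `γ ∈ Γ(X)`: `h^*(γ^* c) = (γ·h)^* c`. -/
theorem map_map_eq_map_mul {X : Motives.SchemeOver ℂ} (h : Aut X) (hh : h ∈ autFixingH2H3 X)
    (γ : autFixingH2H3 X) {k : ℕ} (c : complexBetti X k) :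
    complexBetti.map h.hom k (complexBetti.map γ.val.hom k c) =
      complexBetti.map (γ * ⟨h, hh⟩ : autFixingH2H3 X).val.hom k c := by
  rw [Subgroup.coe_mul, CategoryTheory.Aut.Aut_mul_def, Iso.trans_hom, complexBetti.map_comp,
    CategoryTheory.comp_apply]

variable (X : Motives.SchemeOver ℂ) [Fintype (autFixingH2H3 X)]

/-- **The `Γ(X)`-average** `|Γ(X)|⁻¹ ∑_{γ ∈ Γ(X)} γ^* c` of a class `c ∈ Hᵏ(X(ℂ); ℂ)` (for `Γ(X)`
finite). -/
def gammaAverage (k : ℕ) (c : complexBetti X k) : complexBetti X k :=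
  (Fintype.card (autFixingH2H3 X) : ℂ)⁻¹ • ∑ γ : autFixingH2H3 X, complexBetti.map γ.val.hom k c

variable {X}

/-- The average of a rational class is rational (transport along isomorphisms, `IsoTransport`). -/
theorem isRationalClass_gammaAverage {k : ℕ} {c : complexBetti X k} (hc : IsRationalClass c) :
    IsRationalClass (gammaAverage X k c) := by
  have hsum : IsRationalClass (∑ γ : autFixingH2H3 X, complexBetti.map γ.val.hom k c) :=
    isRationalClass_sum _ _ fun γ _ ↦ (isRationalClass_map_iff_of_iso γ.val).2 hc
  simpa [gammaAverage] using hsum.smul ((Fintype.card (autFixingH2H3 X) : ℚ)⁻¹)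

/-- The average of a class of Hodge type `(p, q)` has Hodge type `(p, q)`. -/
theorem isOfHodgeType_gammaAverage (hX : Motives.IsSmoothProjective 8 X) {k p q : ℕ}
    {c : complexBetti X k} (hc : IsOfHodgeType 8 X k p q c) :
    IsOfHodgeType 8 X k p q (gammaAverage X k c) := by
  obtain ⟨A⟩ := HodgeTheory.nonempty_hodgeModel_holds (n := 8) hX
  exact (IsOfHodgeType.sum hX A Finset.univ (fun γ : autFixingH2H3 X ↦
    complexBetti.map γ.val.hom k c) fun γ _ ↦ (isOfHodgeType_map_iff_of_iso γ.val).2 hc).smul _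

/-- The average is `Γ(X)`-invariant (reindex the sum by `γ ↦ γ·h`). -/
theorem isGammaInvariant_gammaAverage (k : ℕ) (c : complexBetti X k) :
    IsGammaInvariant X (gammaAverage X k c) := by
  intro h hh
  unfold gammaAverage
  change (complexBetti.map h.hom k).hom (_ • _) = _
  rw [map_smul, map_sum]
  congr 1
  refine Fintype.sum_equiv (Equiv.mulRight (⟨h, hh⟩ : autFixingH2H3 X)) _ _ fun γ ↦ ?_
  rw [Equiv.coe_mulRight]
  exact map_map_eq_map_mul h hh γ c

/-- `c - avg(c) = |Γ|⁻¹ ∑_γ (c - γ^* c)` lies in any subspace containing all `γ^* c - c`. -/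
theorem sub_gammaAverage_mem (k : ℕ) (c : complexBetti X k) (S : Submodule ℂ (complexBetti X k))
    (h : ∀ γ : autFixingH2H3 X, complexBetti.map γ.val.hom k c - c ∈ S) :
    c - gammaAverage X k c ∈ S := by
  have hcard : (Fintype.card (autFixingH2H3 X) : ℂ) ≠ 0 := Nat.cast_ne_zero.2 Fintype.card_ne_zero
  have hid : c - gammaAverage X k c = (Fintype.card (autFixingH2H3 X) : ℂ)⁻¹ •
      ∑ γ : autFixingH2H3 X, (c - complexBetti.map γ.val.hom k c) := by
    rw [gammaAverage, Finset.sum_sub_distrib, Finset.sum_const, Finset.card_univ, smul_sub,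
      ← Nat.cast_smul_eq_nsmul ℂ, smul_smul, inv_mul_cancel₀ hcard, one_smul]
  rw [hid]
  refine Submodule.smul_mem _ _ (Submodule.sum_mem _ fun γ _ ↦ ?_)
  rw [← neg_sub]
  exact Submodule.neg_mem _ (h γ)

end Averaging

/-- **KERNEL glue: L3a ∧ L3b ⟹ L3**, by averaging over the finite group `Γ(X)`:
`c₀ := |Γ|⁻¹ ∑_{γ ∈ Γ} γ^* c` (`gammaAverage`) is rational and of type `(p,p)` (transport along
isomorphisms, `HodgeTheory/IsoTransport`; closure under sums and scalars), `Γ`-invariant, and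
`c - c₀ = |Γ|⁻¹ ∑_γ (c - γ^* c)` is algebraic by L3b. -/
theorem fixedFourfoldSpan_of_finite_of_coinvariant (ha : GammaFiniteKum4)
    (hb : GammaCoinvariantClassesAlgebraicKum4) : FixedFourfoldSpanKum4 := by
  intro X hX hK p c hc hpp
  haveI : Finite (autFixingH2H3 X) := ha hX hK
  letI : Fintype (autFixingH2H3 X) := Fintype.ofFinite _
  exact ⟨gammaAverage X (2 * p) c, isRationalClass_gammaAverage hc, isOfHodgeType_gammaAverage hX hpp,
    isGammaInvariant_gammaAverage (2 * p) c,
    sub_gammaAverage_mem (2 * p) c _ fun γ ↦ hb hX hK p c γ.val γ.property⟩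

end Summit.Ventures.HodgeKum4

end
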